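/-
Copyright (c) 2026. All rights reserved.
Released under Apache 2.0 license as described in the file LICENSE.
Authors: abc-iut cell, seat abc-iut-f-081 (F fact-proving wave; follow-up to FACT-LIST row F-0360).
-/
import Literature.AnabelianGeometry.AbsoluteAnabelian.AbsTopIII.FrobeniusPictureMLFCompatibilityTransport
import Literature.AnabelianGeometry.AbsoluteAnabelian.AbsTopIII.FrobeniusPictureMLFCores
import Mathlib.CategoryTheory.SingleObj
import Mathlib.Algebra.Group.Nat.TypeTags
import HarnessLib

/-!
# [AbsTopIII] Cor. 3.6 (iii), second clause, read LITERALLY: what a common family of homotopies forces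
# — the Galois components of `ι_×`, `ι_{log,⋎}` are ISOMORPHISMS (necessity), and a datum without one

S. Mochizuki, *Topics in Absolute Anabelian Geometry III* [MochizukiAbsTopIII2015] (kurims manuscript
`paper:url-5493eb38cbb7`): Cor. 3.6 (iii) p. 80 ("[the family of homotopies of `𝔖_log`] is compatible
with the families of homotopies that constitute the core and telecore structures of (i), (ii)") with
its proof p. 81 l. 21–26 ("immediate from the definitions — i.e., in essence, because the various Galois
groups that appear remain 'undisturbed' …"), Def. 3.5 (ii)/(iii) pp. 75–76 (families of homotopies;
cores are symmetric).

PROOF-ONLY companion (no notion is declared) of `FrobeniusPictureMLFCompatibility.lean` (seat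
abc-iut-L4-t5: `LogObsCompatCoresStmt Δ` = ONE family `K` on `𝒟` containing the `𝔖_log` family and core
families for `(𝒟_{≤4}, ℰ)`, `(𝒟_{≤5}, Anab)`, `(𝒟_{≤6}, ℰ)` along the graph embeddings) and of
`FrobeniusPictureMLFTelecore.lean` (`IotaOverGaloisStmt Δ`, FACT-LIST row F-0360: the typed CONTENT of
the clause, "`ι_×`, `ι_{log,⋎}` lie over the IDENTITY of `ℰ`").

* `DiagramOfCategories.HomotopyFamily.isIso_map_of_postcomp` — Def. 3.5 (ii) bookkeeping on an
  arbitrary diagram: if a family `K` contains a pair `(p, q)` into a vertex `ob` with prescribed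
  components `θ_x`, and its homotopy on the post-composed pair `(p·e, q·e)` along an edge `e : ob → tg`
  is an isomorphism, then every `𝒟_e(θ_x)` is an isomorphism (whiskering axiom (b) of Def. 3.5 (ii)).
* `LogFrobeniusData.isIso_NtoE_map_iotaTimes_of_logObsCompatCoresStmt`,
  `LogFrobeniusData.isIso_NtoE_map_iotaLog_of_logObsCompatCoresStmt` — **NECESSITY**: if the literal
  compatibility clause `LogObsCompatCoresStmt Δ` holds, then after `𝒩 → ℰ` every component of `ι_×` and
  of `ι_{log,⋎}` is an ISOMORPHISM of `ℰ` (the `𝔖_log` pairs post-composed with `𝒩 → ℰ` are pairs of the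
  core `(𝒟_{≤4}, ℰ)`, and a core's family is symmetric, Def. 3.5 (iii), hence consists of isomorphisms).
  This is the part of F-0360 the literal clause recovers; whether the IDENTITY (`IotaOverGaloisStmt`) is
  forced depends on the homotopies of the chosen core structures, which `LogObsCompatCoresStmt` leaves
  free — the parenthetical "a common family forces exactly these two identities" in the docstring of
  `IotaOverGaloisStmt` is recovered here in the weaker form "forces isomorphisms".
* `LogFrobeniusData.exists_not_logObsCompatCoresStmt` / `not_forall_logObsCompatCoresStmt` — the
  literal clause is NOT a consequence of the typing: at the one-object datum of the commutative monoid
  `(ℕ, +)` with `ι_× := 1` (the countermodel of `not_forall_iotaOverGaloisStmt`,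
  `FrobeniusPictureMLFTelecoreClosures.lean`) the Galois component `1` of `ι_×` is not invertible.  (The
  converse construction of a common family from `IotaOverGaloisStmt` is the abc-iut-L4-t5 /
  abc-iut-w5-d053 lineage's `FrobeniusPictureMLFLogGlueFamily`; nothing of it is used here.)

HONEST FRAMING: category-theoretic bookkeeping over the typed data and a toy datum; refereed pre-IUT
material; nothing here bears on [IUTchIII] Cor. 3.12 or takes a side; typed ≠ proved.
-/

namespace Literature.AnabelianGeometry.AbsoluteAnabelian

open _root_.CategoryTheory _root_.Quiver

universe u

/-! ### `eqToHom` / `HEq` bookkeeping -/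

section Bookkeeping

universe v₁ v₂ u₁ u₂

/-- Components of a natural transformation at propositionally equal objects. [folklore] -/
private theorem app_eq_of_obj_eq'' {C : Type u₁} [Category.{v₁} C] {C' : Type u₂} [Category.{v₂} C']
    {F G : C ⥤ C'} (θ : F ⟶ G) {X Y : C} (h : X = Y) :
    θ.app X = eqToHom (by rw [h]) ≫ θ.app Y ≫ eqToHom (by rw [h]) := by
  subst h
  simp

/-- Components of heterogeneously equal natural transformations between equal functors. [folklore] -/
private theorem app_eq_of_heq'' {C : Type u₁} [Category.{v₁} C] {C' : Type u₂} [Category.{v₂} C']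
    {F G F' G' : C ⥤ C'} (hF : F = F') (hG : G = G') {α : F ⟶ G} {β : F' ⟶ G'} (h : HEq α β)
    (X : C) :
    β.app X = eqToHom (Functor.congr_obj hF X).symm ≫ α.app X ≫ eqToHom (Functor.congr_obj hG X) := by
  subst hF hG
  simp [eq_of_heq h]

/-- An isomorphism stays an isomorphism across a heterogeneous equality of natural transformations
between equal functors. [folklore] -/
private theorem isIso_of_heq'' {C : Type u₁} [Category.{v₁} C] {C' : Type u₂} [Category.{v₂} C']
    {F G F' G' : C ⥤ C'} (hF : F = F') (hG : G = G') {α : F ⟶ G} {β : F' ⟶ G'} (h : HEq α β)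
    (hα : IsIso α) : IsIso β := by
  subst hF hG
  rw [← eq_of_heq h]
  exact hα

/-- Merging the `eqToHom`s of a singly nested conjugate. [folklore] -/
private theorem eqToHom_sandwich'' {C : Type u₁} [Category.{v₁} C] {A B₁ B₂ C₁ C₂ E : C} (p : A = B₁)
    (q : B₁ = B₂) (m : B₂ ⟶ C₁) (r : C₁ = C₂) (s : C₂ = E) :
    eqToHom p ≫ (eqToHom q ≫ m ≫ eqToHom r) ≫ eqToHom s =
      eqToHom (p.trans q) ≫ m ≫ eqToHom (r.trans s) := by
  cases p; cases q; cases r; cases s; simp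

/-- `eqToHom` is an isomorphism (explicit form, for goals whose endpoints are only definitionally
those of the `eqToHom`). [folklore] -/
private theorem isIso_eqToHom'' {C : Type u₁} [Category.{v₁} C] {a b : C} (p : a = b) :
    IsIso (eqToHom p) :=
  inferInstance

/-- An isomorphism conjugated by `eqToHom`s is an isomorphism. [folklore] -/
private theorem isIso_eqToHom_sandwich'' {C : Type u₁} [Category.{v₁} C] {a a' b b' : C} (p : a = a')
    (f : a' ⟶ b') (q : b' = b) (hf : IsIso f) : IsIso (eqToHom p ≫ f ≫ eqToHom q) := by
  subst p q
  simpa using hf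

/-- Stripping `eqToHom`s from an isomorphism. [folklore] -/
private theorem isIso_of_isIso_eqToHom_sandwich'' {C : Type u₁} [Category.{v₁} C] {a a' b b' : C}
    (p : a = a') (f : a' ⟶ b') (q : b' = b) (h : IsIso (eqToHom p ≫ f ≫ eqToHom q)) : IsIso f := by
  subst p q
  simpa using h

end Bookkeeping

/-! ### Def. 3.5 (ii): a homotopy post-composed with an edge is the whiskered homotopy -/

namespace DiagramOfCategories.HomotopyFamily

universe v' u' w'

variable {V : Type w'} [Quiver.{v'} V] {D : DiagramOfCategories.{v', u', w'} V} (K : D.HomotopyFamily)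

/-- Homotopies of a family on propositionally equal pairs of paths agree (heterogeneously).
[cite: MochizukiAbsTopIII2015, Definition 3.5 (ii) p.75] -/
theorem η_heq_of_eq {a b : V} {p p' q q' : Path a b} (hp : p = p') (hq : q = q') (h : K.E p q)
    (h' : K.E p' q') : HEq (K.η h) (K.η h') := by
  subst hp hq
  rfl

/-- **Def. 3.5 (ii) (b), post-composition with one edge, componentwise.**  If `(p, q) ∈ E_K` with
homotopy components `ζ_x = θ_x` (through `eqToHom`s of the object identifications) and
`(p·e, q·e) ∈ E_K` for an edge `e`, then the homotopy of the latter pair has components `𝒟_e(θ_x)`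
(through `eqToHom`s). [cite: MochizukiAbsTopIII2015, Definition 3.5 (ii) p.75] -/
theorem η_app_postcomp_edge {a ob tg : V} {p q : Path a ob} (e : ob ⟶ tg)
    {P Q : D.obj a → D.obj ob} (θ : ∀ x, P x ⟶ Q x) (hT : K.E p q)
    (hP : ∀ x, (D.pathFunctor p).obj x = P x) (hQ : ∀ x, (D.pathFunctor q).obj x = Q x)
    (hhT : ∀ (x : D.obj a) (e₁ : (D.pathFunctor p).obj x = P x) (e₂ : (D.pathFunctor q).obj x = Q x),
      (K.η hT).app x = eqToHom e₁ ≫ θ x ≫ eqToHom e₂.symm)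
    (hE : K.E (p.cons e) (q.cons e)) (x : D.obj a) :
    (K.η hE).app x =
      eqToHom ((Functor.congr_obj (D.pathFunctor_cons p e) x).trans (congrArg (D.map e).obj (hP x))) ≫
        (D.map e).map (θ x) ≫
      eqToHom ((Functor.congr_obj (D.pathFunctor_cons q e) x).trans
        (congrArg (D.map e).obj (hQ x))).symm := by
  -- the whiskering axiom, for `r₁ = []`, `r₂ = [e]`
  have W := K.η_whisker hT (Path.nil : Path a a) ((Path.nil : Path ob ob).cons e)
  -- transport from the pair `([]·p·[e], []·q·[e])` to `(p·[e], q·[e])`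
  have hp : (Path.nil : Path a a).comp (p.comp ((Path.nil : Path ob ob).cons e)) = p.cons e := by
    rw [Path.nil_comp]; rfl
  have hq : (Path.nil : Path a a).comp (q.comp ((Path.nil : Path ob ob).cons e)) = q.cons e := by
    rw [Path.nil_comp]; rfl
  have Hη := K.η_heq_of_eq hp hq
    (K.isSaturated.precomp (K.isSaturated.postcomp hT ((Path.nil : Path ob ob).cons e)) Path.nil) hE
  have EF : D.pathFunctor ((Path.nil : Path a a).comp (p.comp ((Path.nil : Path ob ob).cons e))) =
      D.pathFunctor (p.cons e) := by rw [hp]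
  have EG : D.pathFunctor ((Path.nil : Path a a).comp (q.comp ((Path.nil : Path ob ob).cons e))) =
      D.pathFunctor (q.cons e) := by rw [hq]
  rw [app_eq_of_heq'' EF EG Hη x, NatTrans.congr_app W x]
  -- unfold the whiskered transformation at `x`
  have E0 : D.pathFunctor (Path.nil : Path a a) = 𝟭 _ := D.pathFunctor_nil a
  have Ee : D.pathFunctor ((Path.nil : Path ob ob).cons e) = D.map e := by
    rw [D.pathFunctor_cons, D.pathFunctor_nil, Functor.id_comp]
  have hx0 : (D.pathFunctor (Path.nil : Path a a)).obj x = x := Functor.congr_obj E0 x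
  simp only [NatTrans.comp_app, eqToHom_app, Functor.whiskerLeft_app, Functor.whiskerRight_app,
    app_eq_of_obj_eq'' (K.η hT) hx0, hhT x (hP x) (hQ x), Functor.map_comp, eqToHom_map,
    Functor.congr_hom Ee, Category.assoc, eqToHom_trans, eqToHom_trans_assoc]
  exact eqToHom_sandwich'' _ _ _ _ _

/-- **If the post-composed homotopy is an isomorphism, so is every `𝒟_e(θ_x)`** (used below with `K`
a common family, `(p, q)` an `𝔖_log` pair and `e = (𝒩 → ℰ)`, the post-composed pair being a pair of the
core `ℰ`). [cite: MochizukiAbsTopIII2015, Definition 3.5 (ii) p.75] -/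
theorem isIso_map_of_postcomp {a ob tg : V} {p q : Path a ob} (e : ob ⟶ tg)
    {P Q : D.obj a → D.obj ob} (θ : ∀ x, P x ⟶ Q x) (hT : K.E p q)
    (hP : ∀ x, (D.pathFunctor p).obj x = P x) (hQ : ∀ x, (D.pathFunctor q).obj x = Q x)
    (hhT : ∀ (x : D.obj a) (e₁ : (D.pathFunctor p).obj x = P x) (e₂ : (D.pathFunctor q).obj x = Q x),
      (K.η hT).app x = eqToHom e₁ ≫ θ x ≫ eqToHom e₂.symm)
    (hE : K.E (p.cons e) (q.cons e)) (hiso : IsIso (K.η hE)) (x : D.obj a) :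
    IsIso ((D.map e).map (θ x)) := by
  haveI := hiso
  have hc : IsIso ((K.η hE).app x) := inferInstance
  rw [K.η_app_postcomp_edge e θ hT hP hQ hhT hE x] at hc
  exact isIso_of_isIso_eqToHom_sandwich'' _ _ _ hc

end DiagramOfCategories.HomotopyFamily

/-! ### Necessity: the literal clause makes the Galois components of `ι_×`, `ι_{log,⋎}` isomorphisms -/

namespace LogFrobeniusData

open DiagramOfCategories

variable (Δ : LogFrobeniusData.{u})

/-- Object equalities of the type-(2) `𝔖_log` pair read in `𝒟` (along `embLog`): `[λ^×]`, `[λ^{×pf}]` act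
by `λ^×`, `λ^{×pf}`. [cite: MochizukiAbsTopIII2015, Corollary 3.6 (iii) p.81] -/
theorem diagram_timesPair_obj (x : Δ.X) :
    (Δ.diagram.pathFunctor (embLog.mapPath ((Path.nil : Path lvNexus.{u} lvNexus).cons eLamTimes))).obj x =
        Δ.lamTimes.obj x ∧
      (Δ.diagram.pathFunctor (embLog.mapPath ((Path.nil : Path lvNexus.{u} lvNexus).cons eLamPf))).obj x =
        Δ.lamPf.obj x := by
  constructor <;>
    simp only [Prefunctor.mapPath_cons, Prefunctor.mapPath_nil, pathFunctor_cons, pathFunctor_nil] <;> rfl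

/-- Object equalities of the type-(1) `𝔖_log` pair read in `𝒟` (along `embLog`): the two paths act by
`λ^× ∘ id_⋎ ∘ log` and `λ^{×pf} ∘ id_{⋎+1}`. [cite: MochizukiAbsTopIII2015, Corollary 3.6 (iii) p.81] -/
theorem diagram_logPair_obj (n : ℤ) (x : Δ.X₁) :
    (Δ.diagram.pathFunctor (embLog.mapPath (logPairLeft.{u} n))).obj x =
        Δ.lamTimes.obj (Δ.toNexus.obj (Δ.log.obj x)) ∧
      (Δ.diagram.pathFunctor (embLog.mapPath (logPairRight.{u} n))).obj x =
        Δ.lamPf.obj (Δ.toNexus.obj x) := by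
  constructor <;>
    simp only [logPairLeft, logPairRight, Prefunctor.mapPath_cons, Prefunctor.mapPath_nil,
      pathFunctor_cons, pathFunctor_nil] <;> rfl

/-- In a family `K` on `𝒟` realising the cores and `𝔖_log`, the homotopy on any pair of paths of `𝒟`
that is the image of a pair of the core presentation `𝒟_{≤3} ∪ {ℰ}` ending at `ℰ` is an ISOMORPHISM
(cores are symmetric, Def. 3.5 (iii)). [cite: MochizukiAbsTopIII2015, Definition 3.5 (iii) p.75] -/
theorem isIso_η_of_realisesCoresAndLogObs (K : Δ.diagram.HomotopyFamily)
    (hK : Δ.RealisesCoresAndLogObs K) {v : SubVertex {a : LFVertex | a.row ≤ 3}}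
    (P Q : Path (coreShape4.{u}.base v) coreShape4.{u}.obs)
    (hE : K.E (embCore4.mapPath P) (embCore4.mapPath Q)) : IsIso (K.η hE) := by
  obtain ⟨-, ⟨H₄, hH₄, hcore, hc₄⟩, -, -⟩ := hK
  have hb : H₄.E P Q := hcore.boundary_all P Q
  obtain ⟨hE', hheq⟩ := hc₄ P Q hb
  have hsymm : H₄.IsSymmetric := hcore.isSymmetric
  have hF : Δ.core4Diagram.pathFunctor P = Δ.diagram.pathFunctor (embCore4.mapPath P) :=
    eq_of_heq (Δ.heq_pathFunctor_embCore4 P)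
  have hG : Δ.core4Diagram.pathFunctor Q = Δ.diagram.pathFunctor (embCore4.mapPath Q) :=
    eq_of_heq (Δ.heq_pathFunctor_embCore4 Q)
  exact isIso_of_heq'' hF hG hheq (HomotopyFamily.isIso_of_isSymmetric _ _ hsymm hb)

/-- **Necessity, `ι_×`**: if the literal compatibility clause of Cor. 3.6 (iii) holds
(`LogObsCompatCoresStmt Δ`: one family on `𝒟` contains the `𝔖_log` family and the three core
families), then after the projection `𝒩 → ℰ` every component of `ι_×` is an ISOMORPHISM of `ℰ`
(whichever its orientation): the type-(2) pair `([λ^×], [λ^{×pf}])` post-composed with `𝒩 → ℰ` is a pair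
of the core `(𝒟_{≤4}, ℰ)`, whose homotopies are isomorphisms.
[cite: MochizukiAbsTopIII2015, Corollary 3.6 (iii) pp.80–81] -/
theorem isIso_NtoE_map_iotaTimes_of_logObsCompatCoresStmt (h : Δ.LogObsCompatCoresStmt) :
    match Δ.ιtimes with
    | .inl ι => ∀ x : Δ.X, IsIso (Δ.NtoE.map (ι.app x))
    | .inr ι => ∀ x : Δ.X, IsIso (Δ.NtoE.map (ι.app x)) := by
  obtain ⟨K, hK⟩ := h
  obtain ⟨⟨H₃, ⟨-, -, hpin⟩, hc₃⟩, -, -, -⟩ := id hK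
  obtain ⟨htimes, -⟩ := hpin
  -- the type-(2) pair post-composed with `𝒩 → ℰ`, as paths of the core presentation `𝒟_{≤3} ∪ {ℰ}`
  let nx : coreShape4.{u}.Vertex := coreShape4.{u}.base (vx 3 .nexus (by decide))
  let th : coreShape4.{u}.Vertex := coreShape4.{u}.base (vx 3 .third (by decide))
  let PT : Bool → Path nx coreShape4.{u}.obs := fun b =>
    ((Path.nil : Path nx nx).cons (show nx ⟶ th from (ULift.up b : ULift Bool))).cons
      (show th ⟶ coreShape4.{u}.obs from PUnit.unit)
  -- the functor identifications along `embLog` for the two type-(2) paths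
  have hFT : Δ.sub3.pathFunctor ((Path.nil : Path lvNexus.{u} lvNexus).cons eLamTimes) =
      Δ.diagram.pathFunctor (embLog.mapPath ((Path.nil : Path lvNexus.{u} lvNexus).cons eLamTimes)) :=
    eq_of_heq (Δ.heq_pathFunctor_embLog _)
  have hFP : Δ.sub3.pathFunctor ((Path.nil : Path lvNexus.{u} lvNexus).cons eLamPf) =
      Δ.diagram.pathFunctor (embLog.mapPath ((Path.nil : Path lvNexus.{u} lvNexus).cons eLamPf)) :=
    eq_of_heq (Δ.heq_pathFunctor_embLog _)
  revert htimes
  rcases hι : Δ.ιtimes with ι | ι <;> intro htimes <;> obtain ⟨hT, hhT⟩ := htimes <;> intro x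
  · -- §3 orientation `ι_× : λ^× → λ^{×pf}`
    obtain ⟨hT', hheq⟩ := hc₃ _ _ hT
    have hE : K.E (embCore4.mapPath (PT true)) (embCore4.mapPath (PT false)) :=
      K.isSaturated.postcomp hT' ((Path.nil : Path LFVertex.third LFVertex.third).cons LFVertex.edge34)
    have hiso := Δ.isIso_η_of_realisesCoresAndLogObs K hK (PT true) (PT false) hE
    exact K.isIso_map_of_postcomp
      (p := embLog.mapPath ((Path.nil : Path lvNexus.{u} lvNexus).cons eLamTimes))
      (q := embLog.mapPath ((Path.nil : Path lvNexus.{u} lvNexus).cons eLamPf)) LFVertex.edge34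
      (P := fun x => Δ.lamTimes.obj x) (Q := fun x => Δ.lamPf.obj x) (fun x => ι.app x) hT'
      (fun x => (Δ.diagram_timesPair_obj x).1) (fun x => (Δ.diagram_timesPair_obj x).2)
      (fun x e₁ e₂ => by
        rw [app_eq_of_heq'' hFT hFP hheq x, hhT x (Δ.timesPair_obj x).1 (Δ.timesPair_obj x).2]
        exact eqToHom_sandwich'' _ _ _ _ _)
      hE hiso x
  · -- §4 orientation `ι_× : λ^∼ → λ^×`
    obtain ⟨hT', hheq⟩ := hc₃ _ _ hT
    have hE : K.E (embCore4.mapPath (PT false)) (embCore4.mapPath (PT true)) :=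
      K.isSaturated.postcomp hT' ((Path.nil : Path LFVertex.third LFVertex.third).cons LFVertex.edge34)
    have hiso := Δ.isIso_η_of_realisesCoresAndLogObs K hK (PT false) (PT true) hE
    exact K.isIso_map_of_postcomp
      (p := embLog.mapPath ((Path.nil : Path lvNexus.{u} lvNexus).cons eLamPf))
      (q := embLog.mapPath ((Path.nil : Path lvNexus.{u} lvNexus).cons eLamTimes)) LFVertex.edge34
      (P := fun x => Δ.lamPf.obj x) (Q := fun x => Δ.lamTimes.obj x) (fun x => ι.app x) hT'
      (fun x => (Δ.diagram_timesPair_obj x).2) (fun x => (Δ.diagram_timesPair_obj x).1)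
      (fun x e₁ e₂ => by
        rw [app_eq_of_heq'' hFP hFT hheq x, hhT x (Δ.timesPair_obj x).2 (Δ.timesPair_obj x).1]
        exact eqToHom_sandwich'' _ _ _ _ _)
      hE hiso x

/-- **Necessity, `ι_{log,⋎}`**: if the literal compatibility clause of Cor. 3.6 (iii) holds, then after
`𝒩 → ℰ` every component of `ι_{log,⋎}` is an ISOMORPHISM of `ℰ` (the type-(1) pair
`([λ^×]∘[id_⋎]∘[log], [λ^{×pf}]∘[id_{⋎+1}])` at `⋎ = 0`, post-composed with `𝒩 → ℰ`, is a pair of the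
core `(𝒟_{≤4}, ℰ)`). [cite: MochizukiAbsTopIII2015, Corollary 3.6 (iii) pp.80–81] -/
theorem isIso_NtoE_map_iotaLog_of_logObsCompatCoresStmt (h : Δ.LogObsCompatCoresStmt) (x : Δ.X₁) :
    IsIso (Δ.NtoE.map (Δ.ιlog.app x)) := by
  obtain ⟨K, hK⟩ := h
  obtain ⟨⟨H₃, ⟨-, -, hpin⟩, hc₃⟩, -, -, -⟩ := id hK
  obtain ⟨-, hlog⟩ := hpin
  obtain ⟨h₁, hh₁⟩ := hlog 0
  obtain ⟨h₁', hheq⟩ := hc₃ _ _ h₁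
  -- the type-(1) pair at `⋎ = 0` post-composed with `𝒩 → ℰ`, as paths of `𝒟_{≤3} ∪ {ℰ}`
  let nx : coreShape4.{u}.Vertex := coreShape4.{u}.base (vx 3 .nexus (by decide))
  let th : coreShape4.{u}.Vertex := coreShape4.{u}.base (vx 3 .third (by decide))
  let r1 : ℤ → coreShape4.{u}.Vertex := fun n =>
    coreShape4.{u}.base (vx 3 (.row1 n) (by simp [LFVertex.row]))
  let PL : Path (r1 (0 + 1)) coreShape4.{u}.obs :=
    ((((Path.nil : Path (r1 (0 + 1)) (r1 (0 + 1))).cons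
      (show r1 (0 + 1) ⟶ r1 0 from LFVertex.logEdge 0)).cons
      (show r1 0 ⟶ nx from LFVertex.idEdge 0)).cons
      (show nx ⟶ th from LFVertex.lamTimesEdge)).cons
      (show th ⟶ coreShape4.{u}.obs from PUnit.unit)
  let PR : Path (r1 (0 + 1)) coreShape4.{u}.obs :=
    (((Path.nil : Path (r1 (0 + 1)) (r1 (0 + 1))).cons
      (show r1 (0 + 1) ⟶ nx from LFVertex.idEdge (0 + 1))).cons
      (show nx ⟶ th from LFVertex.lamPfEdge)).cons
      (show th ⟶ coreShape4.{u}.obs from PUnit.unit)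
  have hFL : Δ.sub3.pathFunctor (logPairLeft.{u} 0) =
      Δ.diagram.pathFunctor (embLog.mapPath (logPairLeft.{u} 0)) :=
    eq_of_heq (Δ.heq_pathFunctor_embLog _)
  have hFR : Δ.sub3.pathFunctor (logPairRight.{u} 0) =
      Δ.diagram.pathFunctor (embLog.mapPath (logPairRight.{u} 0)) :=
    eq_of_heq (Δ.heq_pathFunctor_embLog _)
  have hE : K.E (embCore4.mapPath PL) (embCore4.mapPath PR) :=
    K.isSaturated.postcomp h₁' ((Path.nil : Path LFVertex.third LFVertex.third).cons LFVertex.edge34)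
  have hiso := Δ.isIso_η_of_realisesCoresAndLogObs K hK PL PR hE
  exact K.isIso_map_of_postcomp (p := embLog.mapPath (logPairLeft.{u} 0))
    (q := embLog.mapPath (logPairRight.{u} 0)) LFVertex.edge34
    (P := fun x => Δ.lamTimes.obj (Δ.toNexus.obj (Δ.log.obj x)))
    (Q := fun x => Δ.lamPf.obj (Δ.toNexus.obj x)) (fun x => Δ.ιlog.app x) h₁'
    (fun x => (Δ.diagram_logPair_obj 0 x).1) (fun x => (Δ.diagram_logPair_obj 0 x).2)
    (fun x e₁ e₂ => by
      rw [app_eq_of_heq'' hFL hFR hheq x, hh₁ x (Δ.logPair_obj 0 x).1 (Δ.logPair_obj 0 x).2]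
      exact eqToHom_sandwich'' _ _ _ _ _)
    hE hiso x

/-! ### Consistency with F-0360, and a datum at which the literal clause fails -/

/-- The necessary condition is implied by the typed content F-0360 (`IotaOverGaloisStmt`: the Galois
components are even IDENTITIES `eqToHom`), `ι_×` clause. [cite: MochizukiAbsTopIII2015, Corollary 3.6 (iii) pp.80–81] -/
theorem isIso_NtoE_map_iotaTimes_of_iotaOverGaloisStmt (h : Δ.IotaOverGaloisStmt) :
    match Δ.ιtimes with
    | .inl ι => ∀ x : Δ.X, IsIso (Δ.NtoE.map (ι.app x))
    | .inr ι => ∀ x : Δ.X, IsIso (Δ.NtoE.map (ι.app x)) := by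
  obtain ⟨h₁, -⟩ := h
  revert h₁
  rcases hι : Δ.ιtimes with ι | ι <;> intro h₁ x <;> rw [h₁ x] <;> exact isIso_eqToHom'' _

/-- The necessary condition is implied by F-0360, `ι_{log,⋎}` clause (`log ≅ 𝟭` is an isomorphism).
[cite: MochizukiAbsTopIII2015, Corollary 3.6 (iii) pp.80–81] -/
theorem isIso_NtoE_map_iotaLog_of_iotaOverGaloisStmt (h : Δ.IotaOverGaloisStmt) (x : Δ.X₁) :
    IsIso (Δ.NtoE.map (Δ.ιlog.app x)) := by
  rw [h.2 x]
  exact isIso_eqToHom_sandwich'' _ _ _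
    (Iso.isIso_hom (Δ.XtoE.mapIso (Δ.toNexus.mapIso (Δ.logIsoId.app x))))

/-- **The literal compatibility clause of Cor. 3.6 (iii) is NOT a consequence of the typing**: there is
an abstract input datum (all six categories the one-object category of the commutative monoid
`(ℕ, +)`, all functors identities, `ι_× := 1` — the countermodel of `not_forall_iotaOverGaloisStmt`) at
which `LogObsCompatCoresStmt` FAILS: the Galois component `1 ∈ (ℕ, +)` of `ι_×` is not invertible,
contradicting `isIso_NtoE_map_iotaTimes_of_logObsCompatCoresStmt`.  (At the models the clause's
content holds: `TFModel.iotaOverGaloisStmt_model`, `AbsTopIII.arch_iotaOverGaloisStmt`.)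
[cite: MochizukiAbsTopIII2015, Corollary 3.6 (iii) pp.80–81] -/
theorem exists_not_logObsCompatCoresStmt : ∃ Δ : LogFrobeniusData.{0}, ¬ Δ.LogObsCompatCoresStmt := by
  let M : Type := Multiplicative ℕ
  let S : Type := CategoryTheory.SingleObj M
  -- the central, non-invertible natural endotransformation `1` of the identity functor
  let ν : 𝟭 S ⟶ 𝟭 S :=
    { app := fun _ => (Multiplicative.ofAdd (1 : ℕ) : M)
      naturality := fun _ _ f => by
        simp only [Functor.id_obj, Functor.id_map]
        exact mul_comm (Multiplicative.ofAdd (1 : ℕ) : M) (f : M) }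
  let Δ : LogFrobeniusData.{0} :=
    { X₁ := S, X := S, toNexus := 𝟭 _, N := S, E := S, A := S,
      log := 𝟭 _, logIsoId := Iso.refl _, lamTimes := 𝟭 _, lamPf := 𝟭 _,
      ιlog := (Functor.rightUnitor (𝟭 S ⋙ 𝟭 S)).hom, ιtimes := Sum.inl ν,
      XtoE := 𝟭 _, NtoE := 𝟭 _, lamTimes_NtoE := Functor.comp_id _, lamPf_NtoE := Functor.comp_id _,
      κ := 𝟭 _, AtoE := 𝟭 _, κ_equiv := inferInstance, κ_inv := Functor.rightUnitor _,
      φ := 𝟭 _, φ_equiv := inferInstance, η := Functor.rightUnitor _ ≪≫ Functor.rightUnitor _ }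
  refine ⟨Δ, fun h => ?_⟩
  have h₁ := Δ.isIso_NtoE_map_iotaTimes_of_logObsCompatCoresStmt h
  have h₂ : IsIso (ν.app (CategoryTheory.SingleObj.star M)) := h₁ (CategoryTheory.SingleObj.star M)
  -- an inverse of `1` in `(ℕ, +)` is absurd
  have h₃ : ν.app (CategoryTheory.SingleObj.star M) ≫ inv (ν.app (CategoryTheory.SingleObj.star M)) =
      𝟙 _ := IsIso.hom_inv_id _
  let g : M := inv (ν.app (CategoryTheory.SingleObj.star M))
  have h₄ : g * Multiplicative.ofAdd (1 : ℕ) = (1 : M) := h₃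
  have h₅ := congrArg Multiplicative.toAdd h₄
  change Multiplicative.toAdd g + 1 = 0 at h₅
  omega

/-- Hence the universal closure of the literal clause over abstract input data is FALSE (it is a
statement about the data of Def. 3.1 / Cor. 1.10, where it holds "immediately from the definitions").
[cite: MochizukiAbsTopIII2015, Corollary 3.6 (iii) pp.80–81] -/
theorem not_forall_logObsCompatCoresStmt : ¬ ∀ Δ : LogFrobeniusData.{0}, Δ.LogObsCompatCoresStmt :=
  fun h => exists_not_logObsCompatCoresStmt.elim fun Δ hΔ => hΔ (h Δ)

end LogFrobeniusData

end Literature.AnabelianGeometry.AbsoluteAnabelian
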